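import Mathlib
import HarnessLib

/-!
# `NoHeavyLowerTail` (crux stmt-CriticalPhenomena-4575), antipodal-Kleitman programme: THEOREM K — the explicit balancing flow of the Boolean
# lattice (a telescoping proof of Kleitman's lemma in the antipodal form)

Support file (seat `prim-ineq-gen-7` gen 50; `--supports stmt-CriticalPhenomena-4575`, closed crux).  No `sorry`, no definitions; standard axioms.
Memo: `run/shared/lean/prim/prim-ineq-gen-7/FINDING-FLOW-g50.md` §2 (THEOREM K).

For `z : Finset (Fin n)` let `Y z i := z ∆ {j | i ≤ j}` (`i : ℕ`): the ANTIPODAL WALK `Y z 0 = zᶜ, Y z 1, …, Y z n = z` flips the coordinates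
`0, 1, …, n−1` in turn.  For any `g`, telescoping gives `g z − g zᶜ = ∑_{k<n} (g (Y z (k+1)) − g (Y z k))` (`walk_telescope`).  The `k`-th steps of
the walks of `z ∋ k` and of `z.erase k` are the same pair traversed in opposite directions (`walk_erase_fst/snd`), so for monotone `f, g` the two
`k`-terms add up to `(f z − f (z.erase k)) · (g (Y z (k+1)) − g (Y z k)) ≥ 0`; summing gives
* `AntitheticCubeFlow.antipodalKleitman_cube_flow` — `0 ≤ ∑ z, f z * (g z − g zᶜ)` for all monotone `f, g : Finset (Fin n) → ℝ`,
i.e. AK of the Boolean lattice, with the explicit flow `φ_g(s → s ∪ {k}) = g (Y (s ∪ {k}) (k+1)) − g (Y (s ∪ {k}) k)` of THEOREM K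
(support `s → insert k s`, condition = the translate of that edge by the coordinates `> k`).  A different proof of the tree's `antipodalKleitman_cube`.
-/

namespace Summit.CriticalPhenomena.PercolationContinuityZ3.Theorems

open Finset

namespace AntitheticCubeFlow

variable {n : ℕ}

/-- Membership in the antipodal walk `Y z i = z ∆ {j | i ≤ j}`. [this work] -/
theorem mem_walk (z : Finset (Fin n)) (i : ℕ) (j : Fin n) :
    j ∈ symmDiff z (univ.filter (fun j : Fin n => i ≤ (j : ℕ))) ↔ (j ∈ z ↔ ¬ (i ≤ (j : ℕ))) := by
  rw [Finset.mem_symmDiff, Finset.mem_filter]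
  simp only [Finset.mem_univ, true_and]
  tauto

/-- `Y z 0 = zᶜ`. [this work] -/
theorem walk_zero (z : Finset (Fin n)) : symmDiff z (univ.filter (fun j : Fin n => 0 ≤ (j : ℕ))) = zᶜ := by
  ext j
  rw [mem_walk, Finset.mem_compl]
  constructor
  · intro h hj; exact (h.1 hj) (Nat.zero_le _)
  · intro h; exact ⟨fun hj => absurd hj h, fun h' => absurd (Nat.zero_le _) h'⟩

/-- `Y z n = z`. [this work] -/
theorem walk_top (z : Finset (Fin n)) : symmDiff z (univ.filter (fun j : Fin n => n ≤ (j : ℕ))) = z := by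
  ext j
  rw [mem_walk]
  have : ¬ (n ≤ (j : ℕ)) := by have := j.isLt; omega
  tauto

/-- Telescoping along the antipodal walk: `g z − g zᶜ = ∑_{k<n} (g (Y z (k+1)) − g (Y z k))`. [this work] -/
theorem walk_telescope (z : Finset (Fin n)) (g : Finset (Fin n) → ℝ) :
    g z - g zᶜ = ∑ k ∈ range n, (g (symmDiff z (univ.filter (fun j : Fin n => k + 1 ≤ (j : ℕ)))) -
      g (symmDiff z (univ.filter (fun j : Fin n => k ≤ (j : ℕ))))) := by
  rw [Finset.sum_range_sub (fun k => g (symmDiff z (univ.filter (fun j : Fin n => k ≤ (j : ℕ))))), walk_zero, walk_top]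

/-- The walk of `z.erase k` at time `k` is the walk of `z` at time `k+1` (for `k ∈ z`). [this work] -/
theorem walk_erase_fst (z : Finset (Fin n)) (k : Fin n) (hk : k ∈ z) :
    symmDiff (z.erase k) (univ.filter (fun j : Fin n => (k : ℕ) ≤ (j : ℕ))) =
      symmDiff z (univ.filter (fun j : Fin n => (k : ℕ) + 1 ≤ (j : ℕ))) := by
  ext j
  rw [mem_walk, mem_walk, Finset.mem_erase]
  by_cases hjk : j = k
  · subst hjk; simp [hk]
  · have hne : (j : ℕ) ≠ (k : ℕ) := fun h => hjk (Fin.ext h)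
    have e1 : ((k : ℕ) ≤ (j : ℕ)) ↔ ((k : ℕ) + 1 ≤ (j : ℕ)) := by omega
    simp only [ne_eq, hjk, not_false_eq_true, true_and, e1]

/-- The walk of `z.erase k` at time `k+1` is the walk of `z` at time `k` (for `k ∈ z`). [this work] -/
theorem walk_erase_snd (z : Finset (Fin n)) (k : Fin n) (hk : k ∈ z) :
    symmDiff (z.erase k) (univ.filter (fun j : Fin n => (k : ℕ) + 1 ≤ (j : ℕ))) =
      symmDiff z (univ.filter (fun j : Fin n => (k : ℕ) ≤ (j : ℕ))) := by
  ext j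
  rw [mem_walk, mem_walk, Finset.mem_erase]
  by_cases hjk : j = k
  · subst hjk; simp [hk]
  · have hne : (j : ℕ) ≠ (k : ℕ) := fun h => hjk (Fin.ext h)
    have e1 : ((k : ℕ) ≤ (j : ℕ)) ↔ ((k : ℕ) + 1 ≤ (j : ℕ)) := by omega
    simp only [ne_eq, hjk, not_false_eq_true, true_and, e1]

/-- One step of the walk goes up at a coordinate of `z`: `Y z k ⊆ Y z (k+1)` for `k ∈ z`. [this work] -/
theorem walk_step_subset (z : Finset (Fin n)) (k : Fin n) (hk : k ∈ z) :
    symmDiff z (univ.filter (fun j : Fin n => (k : ℕ) ≤ (j : ℕ))) ⊆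
      symmDiff z (univ.filter (fun j : Fin n => (k : ℕ) + 1 ≤ (j : ℕ))) := by
  intro j hj
  rw [mem_walk] at hj ⊢
  by_cases hjk : j = k
  · subst hjk; simp [hk] at hj
  · have hne : (j : ℕ) ≠ (k : ℕ) := fun h => hjk (Fin.ext h)
    have e1 : ((k : ℕ) ≤ (j : ℕ)) ↔ ((k : ℕ) + 1 ≤ (j : ℕ)) := by omega
    rwa [← e1]

/-- The `k`-th column is nonnegative: pairing `z ∋ k` with `z.erase k`,
`∑ z, f z * (g (Y z (k+1)) − g (Y z k)) = ∑_{z ∋ k} (f z − f (z.erase k)) * (g (Y z (k+1)) − g (Y z k)) ≥ 0`. [this work] -/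
theorem column_nonneg (f g : Finset (Fin n) → ℝ) (hf : Monotone f) (hg : Monotone g) (k : Fin n) :
    0 ≤ ∑ z : Finset (Fin n), f z * (g (symmDiff z (univ.filter (fun j : Fin n => (k : ℕ) + 1 ≤ (j : ℕ)))) -
      g (symmDiff z (univ.filter (fun j : Fin n => (k : ℕ) ≤ (j : ℕ))))) := by
  set W : Finset (Fin n) → ℝ := fun z => g (symmDiff z (univ.filter (fun j : Fin n => (k : ℕ) + 1 ≤ (j : ℕ)))) -
      g (symmDiff z (univ.filter (fun j : Fin n => (k : ℕ) ≤ (j : ℕ)))) with hW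
  have split : ∑ z : Finset (Fin n), f z * W z =
      ∑ z ∈ univ.filter (fun z : Finset (Fin n) => k ∈ z), f z * W z + ∑ z ∈ univ.filter (fun z : Finset (Fin n) => k ∉ z), f z * W z :=
    (Finset.sum_filter_add_sum_filter_not _ _ _).symm
  -- reindex the second sum by z ↦ insert k z / z ↦ z.erase k
  have reind : ∑ z ∈ univ.filter (fun z : Finset (Fin n) => k ∉ z), f z * W z =
      ∑ z ∈ univ.filter (fun z : Finset (Fin n) => k ∈ z), f (z.erase k) * W (z.erase k) := by
    refine Finset.sum_nbij' (fun z => insert k z) (fun z => z.erase k) ?_ ?_ ?_ ?_ ?_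
    · intro z hz
      exact Finset.mem_filter.2 ⟨Finset.mem_univ _, Finset.mem_insert_self k z⟩
    · intro z hz
      exact Finset.mem_filter.2 ⟨Finset.mem_univ _, Finset.notMem_erase k z⟩
    · intro z hz
      have hz' : k ∉ z := (Finset.mem_filter.1 hz).2
      exact Finset.erase_insert hz'
    · intro z hz
      have hz' : k ∈ z := (Finset.mem_filter.1 hz).2
      exact Finset.insert_erase hz'
    · intro z hz
      have hz' : k ∉ z := (Finset.mem_filter.1 hz).2
      rw [Finset.erase_insert hz']
  -- the erased walk is the reversed step
  have Werase : ∀ z : Finset (Fin n), k ∈ z → W (z.erase k) = - W z := by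
    intro z hz
    simp only [hW, walk_erase_fst z k hz, walk_erase_snd z k hz]
    ring
  rw [split, reind, ← Finset.sum_add_distrib]
  refine Finset.sum_nonneg (fun z hz => ?_)
  have hz' : k ∈ z := (Finset.mem_filter.1 hz).2
  rw [Werase z hz']
  have h1 : f (z.erase k) ≤ f z := hf (Finset.erase_subset k z)
  have h2 : 0 ≤ W z := by
    simp only [hW]
    have := hg (walk_step_subset z k hz')
    linarith
  nlinarith

/-- **THEOREM K (antipodal Kleitman for Boolean lattices by the explicit flow).**  For monotone `f, g : Finset (Fin n) → ℝ`,
`0 ≤ ∑ z, f z * (g z − g zᶜ)`.  Proof: telescope `g z − g zᶜ` along the antipodal walk (`walk_telescope`), exchange the sums, and apply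
`column_nonneg` coordinate by coordinate. [this work] -/
theorem antipodalKleitman_cube_flow (f g : Finset (Fin n) → ℝ) (hf : Monotone f) (hg : Monotone g) :
    0 ≤ ∑ z : Finset (Fin n), f z * (g z - g zᶜ) := by
  have e1 : ∑ z : Finset (Fin n), f z * (g z - g zᶜ) =
      ∑ z : Finset (Fin n), ∑ k ∈ range n, f z * (g (symmDiff z (univ.filter (fun j : Fin n => k + 1 ≤ (j : ℕ)))) -
        g (symmDiff z (univ.filter (fun j : Fin n => k ≤ (j : ℕ))))) := by
    refine Finset.sum_congr rfl (fun z _ => ?_)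
    rw [walk_telescope z g, Finset.mul_sum]
  rw [e1, Finset.sum_comm]
  refine Finset.sum_nonneg (fun k hk => ?_)
  have hkn : k < n := Finset.mem_range.1 hk
  exact column_nonneg f g hf hg ⟨k, hkn⟩

end AntitheticCubeFlow

end Summit.CriticalPhenomena.PercolationContinuityZ3.Theorems
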